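import Literature.Geometry.Kaehler.ComplexTorusPicardNumbersRecursion
import Literature.Geometry.Kaehler.ComplexTorusAbelianSurfaceShimura
import HarnessLib

/-!
# The ranges `R_10 = {1,…,44} ∪ {46} ∪ {50,…,55} ∪ {58} ∪ {65,…,68} ∪ {82, 100}`,
# `R_11 = {1,…,57} ∪ {59, 61} ∪ {65,…,70} ∪ {73} ∪ {82,…,85} ∪ {101, 121}` and
# `R_12 = {1,…,62} ∪ {64,…,72} ∪ {74, 78, 80} ∪ {82,…,87} ∪ {90} ∪ {101,…,104} ∪ {122, 144}` of Picard numbers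
# of abelian varieties (Hulek–Laface 2019, §6.2 algorithm, with Shimura's exclusion of type III at `g = 2`)

Layer `Literature/Geometry/Kaehler`, namespace `Literature.Geometry.Kaehler.ComplexTorus`; lane
`lit-hodgefound` (Track 2 foundations library), Layer A4 (row A4-13); seat p18 gen 9, row g9-#2.  THEOREMS
ONLY (no definition, no named fact; D-0026, net debt 0).  Sequel of `ComplexTorusPicardNumbersRecursion.lean`
(Q817: the recursion `R_g ⊆ ⋃_{k∣g} {ρ(Aᵏ)} ∪ ⋃_n (R_n + R_{g−n})` of step (iv) as a theorem, `R_6, …, R_9`; its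
docstring: «Not covered: `R_10` and beyond.  At `g = 10` the isotypic factor `S⁵` of a simple abelian surface
`S` contributes `5ρ(S) + 10·dim_ℚ End_ℚ(S)`, and the tree's classification of simple abelian surfaces still
allows the type-III line `(ρ, dim) = (1, 4)` (value `45`), which Shimura's theorem excludes for simple
surfaces; `45 ∈ R_10` is undecided here») and of `ComplexTorusAbelianSurfaceShimura.lean` (g9-#1: for a
simple abelian surface `(ρ(S), dim_ℚ End_ℚ(S)) ∈ {(1,1), (2,2), (3,4), (2,4)}` — Shimura's exclusions), which
decides it: **`45 ∉ R_10`**.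

Source [HulekLaface2019PicardNumbersAV] K. Hulek, R. Laface, *On the Picard numbers of abelian varieties*,
Ann. Sc. Norm. Super. Pisa (2019), §6.2 «Computing `R_g` for small `g`» (held text `paper:arxiv-1703.05882`,
p0011–p0012), VERBATIM: "Let us consider `g ≥ 4` and suppose we know `R_{g'}` for `g' < g`; then, we compute
`R_g` as follows: (i) By Proposition 6.4, `R_g ⊃ {1, …, 2g−1}`. […] (ii) Compute all possible Picard numbers
of self-product abelian varieties `A^k`, where `dim A = g/k`. […] (iii) For every pair `(g_1, g_2)` such that
`1 ≤ g_1 ≤ g_2 ≤ g−1` and `g_1 + g_2 = g`, compute `R_{g_1} + R_{g_2}` […] (iv) Assemble everything in light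
of the following formula: `R_g = ⋃_{k | g} {ρ(A^k) | A simple, dim A = g/k} ∪ ⋃_{1 ≤ n ≤ g−1} (R_n + R_{g−n})`."
with §5.1 Prop. 5.1 (the type-III line with `m = g/2e = 1` does not occur for simple `X`) and §2.2 Prop. 2.4
(`ρ(Aᵏ)` by type).  The VALUES below are the algorithm's output (the held text prints the algorithm and
`R_1, R_2, R_3`, not these lists).

## What is proved (theorems only)

* §1 `IsSimple.finrank_neronSeveriGroup_pow_of_mul_finrank_eq_ten`: the isotypic factors `Xⁿ` of dimension
  `n · dim X = 10` (step (ii)): `ρ(Xⁿ) ≤ 30 ∨ ρ(Xⁿ) ∈ {50, 55, 100}` — `(dim X, n) = (10, 1)`: `ρ ≤ 20`;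
  `(5, 2)`: `2ρ + e ≤ 30`; `(2, 5)`: `5ρ + 10e ∈ {15, 30, 55, 50}` by the Shimura-sharp surface list (the
  type-III value `45` and the imaginary-quadratic value `25` of the unrestricted table are gone); `(1, 10)`:
  `10 + 45e ∈ {55, 100}`;  **`picardNumbers_ten`**: `R_10 = {1,…,44} ∪ {46} ∪ {50,…,55} ∪ {58} ∪ {65,…,68} ∪
  {82, 100}` (so `45, 47, 48, 49, 56, 57, 59, …, 64 ∉ R_10`); `not_mem_picardNumbers_ten_45` records
  `45 ∉ R_10`.
* §2 `IsSimple.finrank_neronSeveriGroup_pow_of_mul_finrank_eq_eleven` (`n · dim X = 11`: `ρ ≤ 22 ∨ ρ ∈ {66, 121}`)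
  and **`picardNumbers_eleven`**: `R_11 = {1,…,57} ∪ {59, 61} ∪ {65,…,70} ∪ {73} ∪ {82,…,85} ∪ {101, 121}`
  (in particular `58 ∈ R_10` but `58 ∉ R_11`, while `59 ∈ R_11`).
* §3 `IsSimple.finrank_neronSeveriGroup_pow_of_mul_finrank_eq_twelve` (`n · dim X = 12`: `ρ ≤ 48 ∨ ρ ∈ {72, 78,
  144}`; the factors `X³` of simple abelian FOURFOLDS are only bounded by `3ρ + 3e ≤ 48`, `e ∣ 8` — the
  fourfold table is not in the tree and is not needed: every value `≤ 48` lies in `R_12` anyway) and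
  **`picardNumbers_twelve`**: `R_12 = {1,…,62} ∪ {64,…,72} ∪ {74, 78, 80} ∪ {82,…,87} ∪ {90} ∪ {101,…,104} ∪
  {122, 144}`.  Not treated: `g ≥ 13`.

Witnesses (all from the tree): `{1, …, 2g}` (Prop. 6.4, `Icc_one_two_mul_subset_picardNumbers`), `R_{g−1} + 1`
(`image_succ_picardNumbers_subset`), `t² + R_m ⊆ R_{t+m}` (`sq_add_mem_picardNumbers_of_mem`: `E^t × B` with `E`
a CM curve and `Hom(E, B) = 0`), Remark 6.5's `C(d+1, 2) + Σ e_s²` (`choose_add_sum_sq_mem_picardNumbers`).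

## References

* [HulekLaface2019PicardNumbersAV] K. Hulek, R. Laface, *On the Picard numbers of abelian varieties*, Ann.
  Sc. Norm. Super. Pisa (5) XIX (2019), §6.2 (algorithm (i)–(iv)), Prop. 6.4, Remark 6.5, §5.1 Prop. 5.1,
  §2.2 Prop. 2.4 and Cor. 2.5.
* [Shimura1963AnalyticFamilies] G. Shimura, *On analytic families of polarized abelian varieties and
  automorphic functions*, Ann. of Math. (2) 78 (1963), §4 (via Hulek–Laface Prop. 5.1).
-/

noncomputable section

open Module Matrix

namespace Literature.Geometry.Kaehler

namespace ComplexTorus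

universe u

/-! ## §1 Isotypic factors of dimension `10` and `R_10` -/

section Ten

variable {E : Type u} [NormedAddCommGroup E] [NormedSpace ℂ E]

/-- The covering space of a complex torus is finite-dimensional over `ℂ`. [folklore] -/
private theorem finiteDimensional_complex_of_period₁₀ {ι : Type*} [Fintype ι] (Φ : (ι → ℝ) ≃L[ℝ] E) :
    FiniteDimensional ℂ E := by
  haveI : FiniteDimensional ℝ E := LinearEquiv.finiteDimensional Φ.toLinearEquiv
  exact Module.Finite.of_restrictScalars_finite ℝ ℂ E

/-- **Isotypic factors of dimension `10`**: `X` simple abelian, `n · dim X = 10` ⇒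
`ρ(Xⁿ) ≤ 30 ∨ ρ(Xⁿ) ∈ {50, 55, 100}` (`(dim X, n) = (10,1)`: `ρ ≤ 20`; `(5,2)`: `2ρ + e ≤ 30`; `(2,5)`:
`5ρ + 10e ∈ {15, 30, 55, 50}` by the Shimura-sharp list for simple abelian surfaces — NOT `45`; `(1,10)`:
`10 + 45e ∈ {55, 100}`).
[cite: HulekLaface2019PicardNumbersAV, §6.2 (algorithm (ii)) with §2.2 Prop. 2.4, Cor. 2.5 and §5.1 Prop. 5.1] -/
theorem IsSimple.finrank_neronSeveriGroup_pow_of_mul_finrank_eq_ten {ι : Type} [Fintype ι] [DecidableEq ι]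
    [Nonempty ι] {X : (ι → ℝ) ≃L[ℝ] E} (hX : IsSimple X) (hA : IsAbelianVariety X) {n : ℕ} (hn : 0 < n)
    (hm : n * finrank ℂ E = 10) :
    finrank ℤ (neronSeveriGroup (powPeriod X n)) ≤ 30 ∨ finrank ℤ (neronSeveriGroup (powPeriod X n)) = 50 ∨
      finrank ℤ (neronSeveriGroup (powPeriod X n)) = 55 ∨ finrank ℤ (neronSeveriGroup (powPeriod X n)) = 100 := by
  haveI : FiniteDimensional ℂ E := finiteDimensional_complex_of_period₁₀ X
  have hρn : finrank ℤ (neronSeveriGroup (powPeriod X n)) =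
      n * finrank ℤ (neronSeveriGroup X) + n.choose 2 * finrank ℚ (endAlgRat X) :=
    hA.finrank_neronSeveriGroup_pow n
  have hpe : finrank ℤ (neronSeveriGroup X) ≤ finrank ℚ (endAlgRat X) :=
    hA.finrank_neronSeveriGroup_le_finrank_endAlgRat
  have hed : finrank ℚ (endAlgRat X) ∣ 2 * finrank ℂ E := hX.finrank_endAlgRat_dvd_two_mul_finrank
  have he1 : 1 ≤ finrank ℚ (endAlgRat X) := one_le_finrank_endAlgRat X
  have hp1 : finrank ℂ E = 1 → finrank ℤ (neronSeveriGroup X) = 1 := fun h ↦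
    finrank_neronSeveriGroup_eq_one_of_finrank_eq_one X h
  have hp2 : finrank ℂ E = 2 →
      (finrank ℤ (neronSeveriGroup X) = 1 ∧ finrank ℚ (endAlgRat X) = 1) ∨
        (finrank ℤ (neronSeveriGroup X) = 2 ∧ finrank ℚ (endAlgRat X) = 2) ∨
        (finrank ℤ (neronSeveriGroup X) = 3 ∧ finrank ℚ (endAlgRat X) = 4) ∨
        (finrank ℤ (neronSeveriGroup X) = 2 ∧ finrank ℚ (endAlgRat X) = 4) := fun h ↦ by
    obtain ⟨η, hη⟩ := hA
    exact hX.finrank_neronSeveriGroup_and_finrank_endAlgRat_of_finrank_eq_two hη h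
  have hdpos : 0 < finrank ℂ E := finrank_pos_of_nonempty X
  set p := finrank ℤ (neronSeveriGroup X) with hp
  set e := finrank ℚ (endAlgRat X) with he
  set d := finrank ℂ E with hd
  rw [hρn]
  have hn10 : n ≤ 10 := by nlinarith
  interval_cases n
  · have hd10 : d = 10 := by omega
    rw [hd10] at hed
    have := Nat.le_of_dvd (by norm_num) hed
    simp only [one_mul, show Nat.choose 1 2 = 0 by decide, zero_mul, add_zero]
    omega
  · have hd5 : d = 5 := by omega
    rw [hd5] at hed
    have := Nat.le_of_dvd (by norm_num) hed
    simp only [show Nat.choose 2 2 = 1 by decide, one_mul]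
    omega
  · omega
  · omega
  · have hd2 : d = 2 := by omega
    simp only [show Nat.choose 5 2 = 10 by decide]
    rcases hp2 hd2 with ⟨h1, h2⟩ | ⟨h1, h2⟩ | ⟨h1, h2⟩ | ⟨h1, h2⟩ <;> omega
  · omega
  · omega
  · omega
  · omega
  · have hd1 : d = 1 := by omega
    rw [hd1] at hed
    have h2 := Nat.le_of_dvd (by norm_num) hed
    have h1 := hp1 hd1
    simp only [show Nat.choose 10 2 = 45 by decide]
    interval_cases e <;> omega

/-- **`R_10 = {1, …, 44} ∪ {46} ∪ {50, …, 55} ∪ {58} ∪ {65, …, 68} ∪ {82, 100}`** — the algorithm of §6.2 at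
`g = 10` (step (iv) with `R_1, …, R_9`, the simple-surface list WITHOUT the type-III line, so that the
isotypic factor `S⁵` cannot contribute `45`; witnesses: `{1, …, 20}` (Prop. 6.4), `R_9 + 1`, `35 = 2² + 31`,
`37 = 3² + 28`, `44 = 2² + 40`, `50 = 7² + 1`, `55 = 7² + 6`, `58 = 7² + 9`, `65, …, 68 = 8² + {1, 2, 3, 4}`,
`82 = 9² + 1`, `100 = 10²`).  In particular `45, 47, 48, 49, 56, 57, 59, …, 64 ∉ R_10`.  The value is the
algorithm's output (not printed in the held text). [cite: HulekLaface2019PicardNumbersAV, §6.2 (algorithm (i)–(iv)) with Prop. 6.4, Remark 6.5, §5.1 Prop. 5.1] -/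
theorem picardNumbers_ten :
    picardNumbers 10 = Set.Icc 1 44 ∪ {46} ∪ Set.Icc 50 55 ∪ {58} ∪ Set.Icc 65 68 ∪ {82, 100} := by
  ext x
  constructor
  · intro hx
    have hx100 := picardNumbers_subset_Icc (by norm_num : 1 ≤ 10) hx
    rw [Set.mem_Icc] at hx100
    obtain ⟨A, hA, rfl⟩ := hx
    have hS := hA.finrank_neronSeveriGroup_mem_of_pow_of_add (by rw [Module.finrank_fin_fun]; norm_num)
      {y | y ≤ 44 ∨ y = 46 ∨ (50 ≤ y ∧ y ≤ 55) ∨ y = 58 ∨ (65 ≤ y ∧ y ≤ 68) ∨ y = 82 ∨ y = 100}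
      (fun κ _ _ _ F _ _ X hX hXab n hn hm ↦ by
        rw [Module.finrank_fin_fun] at hm
        rcases hX.finrank_neronSeveriGroup_pow_of_mul_finrank_eq_ten hXab hn hm with h | h | h | h <;>
          simp only [Set.mem_setOf_eq] <;> omega)
      (fun m hm0 hm10 a ha b hb ↦ by
        rw [Module.finrank_fin_fun] at hm10 hb
        simp only [Set.mem_setOf_eq]
        interval_cases m
        · rw [picardNumbers_one] at ha; rw [picardNumbers_nine] at hb
          simp only [Set.mem_singleton_iff, Set.mem_union, Set.mem_Icc, Set.mem_insert_iff] at ha hb; omega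
        · rw [picardNumbers_two] at ha; rw [picardNumbers_eight] at hb
          simp only [Set.mem_singleton_iff, Set.mem_union, Set.mem_Icc, Set.mem_insert_iff] at ha hb; omega
        · rw [picardNumbers_three] at ha; rw [picardNumbers_seven] at hb
          simp only [Set.mem_singleton_iff, Set.mem_union, Set.mem_Icc, Set.mem_insert_iff] at ha hb; omega
        · rw [picardNumbers_four] at ha; rw [picardNumbers_six] at hb
          simp only [Set.mem_singleton_iff, Set.mem_union, Set.mem_Icc, Set.mem_insert_iff] at ha hb; omega
        · rw [picardNumbers_five] at ha; rw [picardNumbers_five] at hb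
          simp only [Set.mem_singleton_iff, Set.mem_union, Set.mem_Icc, Set.mem_insert_iff] at ha hb; omega
        · rw [picardNumbers_six] at ha; rw [picardNumbers_four] at hb
          simp only [Set.mem_singleton_iff, Set.mem_union, Set.mem_Icc, Set.mem_insert_iff] at ha hb; omega
        · rw [picardNumbers_seven] at ha; rw [picardNumbers_three] at hb
          simp only [Set.mem_singleton_iff, Set.mem_union, Set.mem_Icc, Set.mem_insert_iff] at ha hb; omega
        · rw [picardNumbers_eight] at ha; rw [picardNumbers_two] at hb
          simp only [Set.mem_singleton_iff, Set.mem_union, Set.mem_Icc, Set.mem_insert_iff] at ha hb; omega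
        · rw [picardNumbers_nine] at ha; rw [picardNumbers_one] at hb
          simp only [Set.mem_singleton_iff, Set.mem_union, Set.mem_Icc, Set.mem_insert_iff] at ha hb; omega)
    simp only [Set.mem_setOf_eq] at hS
    simp only [Set.mem_union, Set.mem_Icc, Set.mem_insert_iff, Set.mem_singleton_iff]
    omega
  · have hsucc : ∀ y ∈ picardNumbers 9, y + 1 ∈ picardNumbers 10 := fun y hy ↦
      image_succ_picardNumbers_subset 9 ⟨y, hy, rfl⟩
    have hR9 : ∀ y, y ∈ Set.Icc 1 33 ∪ {35} ∪ Set.Icc 37 42 ∪ {45} ∪ Set.Icc 50 53 ∪ ({65, 81} : Set ℕ) →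
        y ∈ picardNumbers 9 := fun y hy ↦ by rw [picardNumbers_nine]; exact hy
    have hR8 : ∀ y, y ∈ Set.Icc 1 32 ∪ {34} ∪ Set.Icc 36 40 ∪ ({50, 64} : Set ℕ) → y ∈ picardNumbers 8 :=
      fun y hy ↦ by rw [picardNumbers_eight]; exact hy
    have hR7 : ∀ y, y ∈ Set.Icc 1 22 ∪ Set.Icc 25 29 ∪ ({37, 49} : Set ℕ) → y ∈ picardNumbers 7 :=
      fun y hy ↦ by rw [picardNumbers_seven]; exact hy
    have hR3 : ∀ y, y ∈ Set.Icc 1 6 ∪ ({9} : Set ℕ) → y ∈ picardNumbers 3 :=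
      fun y hy ↦ by rw [picardNumbers_three]; exact hy
    have hR2 : ∀ y, y ∈ ({1, 2, 3, 4} : Set ℕ) → y ∈ picardNumbers 2 :=
      fun y hy ↦ by rw [picardNumbers_two]; exact hy
    -- `t² + y`, `y ∈ R_m`, realised in dimension `t + m`
    have hsq : ∀ {m y : ℕ}, y ∈ picardNumbers m → ∀ t : ℕ, t + m = 10 → t ^ 2 + y ∈ picardNumbers 10 :=
      fun hy t ht ↦ ht ▸ sq_add_mem_picardNumbers_of_mem hy t
    rintro (((((hx | hx) | hx) | hx) | hx) | hx)
    · rw [Set.mem_Icc] at hx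
      rcases Nat.lt_or_ge x 21 with h20 | h21
      · exact Icc_one_two_mul_subset_picardNumbers (g := 10) (by norm_num) (Set.mem_Icc.2 ⟨hx.1, by omega⟩)
      · rcases Nat.lt_or_ge x 35 with h34 | h35
        · have h := hsucc (x - 1) (hR9 (x - 1) (by simp only [Set.mem_union, Set.mem_Icc]; omega))
          rwa [show x - 1 + 1 = x by omega] at h
        · rcases (show x = 35 ∨ x = 36 ∨ x = 37 ∨ (38 ≤ x ∧ x ≤ 43) ∨ x = 44 by omega) with
            rfl | rfl | rfl | h38 | rfl
          · exact hsq (hR8 31 (by simp)) 2 rfl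
          · exact hsucc 35 (hR9 35 (by simp))
          · exact hsq (hR7 28 (by simp)) 3 rfl
          · have h := hsucc (x - 1) (hR9 (x - 1) (by simp only [Set.mem_union, Set.mem_Icc]; omega))
            rwa [show x - 1 + 1 = x by omega] at h
          · exact hsq (hR8 40 (by simp)) 2 rfl
    · rw [Set.mem_singleton_iff] at hx
      subst hx
      exact hsucc 45 (hR9 45 (by simp))
    · rw [Set.mem_Icc] at hx
      rcases (show x = 50 ∨ (51 ≤ x ∧ x ≤ 54) ∨ x = 55 by omega) with rfl | h51 | rfl
      · simpa using sq_add_one_mem_picardNumbers_add (k := 3) (by norm_num) 7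
      · have h := hsucc (x - 1) (hR9 (x - 1) (by simp only [Set.mem_union, Set.mem_Icc]; omega))
        rwa [show x - 1 + 1 = x by omega] at h
      · exact hsq (hR3 6 (by simp)) 7 rfl
    · rw [Set.mem_singleton_iff] at hx
      subst hx
      exact hsq (hR3 9 (by simp)) 7 rfl
    · rw [Set.mem_Icc] at hx
      have h := hsq (hR2 (x - 64) (by
        simp only [Set.mem_insert_iff, Set.mem_singleton_iff]; omega)) 8 rfl
      rwa [show 8 ^ 2 + (x - 64) = x by omega] at h
    · rcases hx with rfl | hx
      · simpa using sq_add_one_mem_picardNumbers_add (k := 1) (by norm_num) 9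
      · rw [Set.mem_singleton_iff] at hx
        subst hx
        simpa using choose_add_sum_sq_mem_picardNumbers (S := Unit) (fun _ ↦ 10) 0

/-- **`45 ∉ R_10`**: no complex abelian variety of dimension `10` has Picard number `45` — the value the
type-III line `(ρ, dim_ℚ End) = (1, 4)` of a simple abelian surface `S` would contribute through `S⁵`
(`5·1 + 10·4`), excluded by Shimura's theorem; no other isotypic factor or sum `R_n + R_{10−n}` reaches it.
[cite: HulekLaface2019PicardNumbersAV, §6.2 (algorithm (iv)) with §5.1 Prop. 5.1, exceptional case (1)] -/
theorem not_mem_picardNumbers_ten_45 : 45 ∉ picardNumbers 10 := by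
  rw [picardNumbers_ten]
  simp only [Set.mem_union, Set.mem_Icc, Set.mem_insert_iff, Set.mem_singleton_iff]
  omega

end Ten

/-! ## §2 Isotypic factors of dimension `11` and `R_11` -/

section Eleven

variable {E : Type u} [NormedAddCommGroup E] [NormedSpace ℂ E]

/-- The covering space of a complex torus is finite-dimensional over `ℂ`. [folklore] -/
private theorem finiteDimensional_complex_of_period₁₁ {ι : Type*} [Fintype ι] (Φ : (ι → ℝ) ≃L[ℝ] E) :
    FiniteDimensional ℂ E := by
  haveI : FiniteDimensional ℝ E := LinearEquiv.finiteDimensional Φ.toLinearEquiv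
  exact Module.Finite.of_restrictScalars_finite ℝ ℂ E

/-- **Isotypic factors of dimension `11`**: `X` simple abelian, `n · dim X = 11` ⇒
`ρ(Xⁿ) ≤ 22 ∨ ρ(Xⁿ) ∈ {66, 121}` (`11` is prime: `(dim X, n) = (11, 1)`: `ρ ≤ dim_ℚ End ≤ 22`; `(1, 11)`:
`11 + 55e ∈ {66, 121}`). [cite: HulekLaface2019PicardNumbersAV, §6.2 (algorithm (ii)) with §2.2 Cor. 2.5] -/
theorem IsSimple.finrank_neronSeveriGroup_pow_of_mul_finrank_eq_eleven {ι : Type} [Fintype ι] [DecidableEq ι]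
    [Nonempty ι] {X : (ι → ℝ) ≃L[ℝ] E} (hX : IsSimple X) (hA : IsAbelianVariety X) {n : ℕ} (hn : 0 < n)
    (hm : n * finrank ℂ E = 11) :
    finrank ℤ (neronSeveriGroup (powPeriod X n)) ≤ 22 ∨ finrank ℤ (neronSeveriGroup (powPeriod X n)) = 66 ∨
      finrank ℤ (neronSeveriGroup (powPeriod X n)) = 121 := by
  haveI : FiniteDimensional ℂ E := finiteDimensional_complex_of_period₁₁ X
  have hρn : finrank ℤ (neronSeveriGroup (powPeriod X n)) =
      n * finrank ℤ (neronSeveriGroup X) + n.choose 2 * finrank ℚ (endAlgRat X) :=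
    hA.finrank_neronSeveriGroup_pow n
  have hpe : finrank ℤ (neronSeveriGroup X) ≤ finrank ℚ (endAlgRat X) :=
    hA.finrank_neronSeveriGroup_le_finrank_endAlgRat
  have hed : finrank ℚ (endAlgRat X) ∣ 2 * finrank ℂ E := hX.finrank_endAlgRat_dvd_two_mul_finrank
  have he1 : 1 ≤ finrank ℚ (endAlgRat X) := one_le_finrank_endAlgRat X
  have hp1 : finrank ℂ E = 1 → finrank ℤ (neronSeveriGroup X) = 1 := fun h ↦
    finrank_neronSeveriGroup_eq_one_of_finrank_eq_one X h
  have hdpos : 0 < finrank ℂ E := finrank_pos_of_nonempty X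
  set p := finrank ℤ (neronSeveriGroup X) with hp
  set e := finrank ℚ (endAlgRat X) with he
  set d := finrank ℂ E with hd
  rw [hρn]
  have hn11 : n ≤ 11 := by nlinarith
  -- `n ∣ 11`: `n = 1` or `n = 11`
  have hn' : n = 1 ∨ n = 11 := by
    have hdvd : n ∣ 11 := Dvd.intro _ hm
    rcases (Nat.dvd_prime (by norm_num)).1 hdvd with h | h
    · exact Or.inl h
    · exact Or.inr h
  rcases hn' with rfl | rfl
  · have hd11 : d = 11 := by omega
    rw [hd11] at hed
    have := Nat.le_of_dvd (by norm_num) hed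
    simp only [one_mul, show Nat.choose 1 2 = 0 by decide, zero_mul, add_zero]
    omega
  · have hd1 : d = 1 := by omega
    rw [hd1] at hed
    have h2 := Nat.le_of_dvd (by norm_num) hed
    have h1 := hp1 hd1
    simp only [show Nat.choose 11 2 = 55 by decide]
    interval_cases e <;> omega

/-- **`R_11 = {1, …, 57} ∪ {59, 61} ∪ {65, …, 70} ∪ {73} ∪ {82, …, 85} ∪ {101, 121}`** — the algorithm of §6.2
at `g = 11` (step (iv) with `R_1, …, R_10`; `11` prime, so the only isotypic factors are simple `11`-folds
(`ρ ≤ 22`) and `E¹¹` (`66, 121`); witnesses: `{1, …, 22}` (Prop. 6.4), `R_10 + 1`, `46 = 2² + 42`,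
`48 = 3² + 39`, `49 = 2² + 45`, `50 = 7² + 1`, `57 = 2² + 53`, `61 = 6² + 25`, `65 = 8² + 1`, `70 = 8² + 6`,
`73 = 8² + 9`, `82, …, 85 = 9² + {1, …, 4}`, `101 = 10² + 1`, `121 = 11²`).  In particular `58 ∉ R_11`
(although `58 ∈ R_10`), `60, 62, 63, 64, 71, 72, 74, …, 81 ∉ R_11`.  The value is the algorithm's output.
[cite: HulekLaface2019PicardNumbersAV, §6.2 (algorithm (i)–(iv)) with Prop. 6.4, Remark 6.5] -/
theorem picardNumbers_eleven :
    picardNumbers 11 = Set.Icc 1 57 ∪ {59, 61} ∪ Set.Icc 65 70 ∪ {73} ∪ Set.Icc 82 85 ∪ {101, 121} := by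
  ext x
  constructor
  · intro hx
    have hx121 := picardNumbers_subset_Icc (by norm_num : 1 ≤ 11) hx
    rw [Set.mem_Icc] at hx121
    obtain ⟨A, hA, rfl⟩ := hx
    have hS := hA.finrank_neronSeveriGroup_mem_of_pow_of_add (by rw [Module.finrank_fin_fun]; norm_num)
      {y | y ≤ 57 ∨ y = 59 ∨ y = 61 ∨ (65 ≤ y ∧ y ≤ 70) ∨ y = 73 ∨ (82 ≤ y ∧ y ≤ 85) ∨ y = 101 ∨ y = 121}
      (fun κ _ _ _ F _ _ X hX hXab n hn hm ↦ by
        rw [Module.finrank_fin_fun] at hm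
        rcases hX.finrank_neronSeveriGroup_pow_of_mul_finrank_eq_eleven hXab hn hm with h | h | h <;>
          simp only [Set.mem_setOf_eq] <;> omega)
      (fun m hm0 hm11 a ha b hb ↦ by
        rw [Module.finrank_fin_fun] at hm11 hb
        simp only [Set.mem_setOf_eq]
        interval_cases m
        · rw [picardNumbers_one] at ha; rw [picardNumbers_ten] at hb
          simp only [Set.mem_singleton_iff, Set.mem_union, Set.mem_Icc, Set.mem_insert_iff] at ha hb; omega
        · rw [picardNumbers_two] at ha; rw [picardNumbers_nine] at hb
          simp only [Set.mem_singleton_iff, Set.mem_union, Set.mem_Icc, Set.mem_insert_iff] at ha hb; omega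
        · rw [picardNumbers_three] at ha; rw [picardNumbers_eight] at hb
          simp only [Set.mem_singleton_iff, Set.mem_union, Set.mem_Icc, Set.mem_insert_iff] at ha hb; omega
        · rw [picardNumbers_four] at ha; rw [picardNumbers_seven] at hb
          simp only [Set.mem_singleton_iff, Set.mem_union, Set.mem_Icc, Set.mem_insert_iff] at ha hb; omega
        · rw [picardNumbers_five] at ha; rw [picardNumbers_six] at hb
          simp only [Set.mem_singleton_iff, Set.mem_union, Set.mem_Icc, Set.mem_insert_iff] at ha hb; omega
        · rw [picardNumbers_six] at ha; rw [picardNumbers_five] at hb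
          simp only [Set.mem_singleton_iff, Set.mem_union, Set.mem_Icc, Set.mem_insert_iff] at ha hb; omega
        · rw [picardNumbers_seven] at ha; rw [picardNumbers_four] at hb
          simp only [Set.mem_singleton_iff, Set.mem_union, Set.mem_Icc, Set.mem_insert_iff] at ha hb; omega
        · rw [picardNumbers_eight] at ha; rw [picardNumbers_three] at hb
          simp only [Set.mem_singleton_iff, Set.mem_union, Set.mem_Icc, Set.mem_insert_iff] at ha hb; omega
        · rw [picardNumbers_nine] at ha; rw [picardNumbers_two] at hb
          simp only [Set.mem_singleton_iff, Set.mem_union, Set.mem_Icc, Set.mem_insert_iff] at ha hb; omega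
        · rw [picardNumbers_ten] at ha; rw [picardNumbers_one] at hb
          simp only [Set.mem_singleton_iff, Set.mem_union, Set.mem_Icc, Set.mem_insert_iff] at ha hb; omega)
    simp only [Set.mem_setOf_eq] at hS
    simp only [Set.mem_union, Set.mem_Icc, Set.mem_insert_iff, Set.mem_singleton_iff]
    omega
  · have hsucc : ∀ y ∈ picardNumbers 10, y + 1 ∈ picardNumbers 11 := fun y hy ↦
      image_succ_picardNumbers_subset 10 ⟨y, hy, rfl⟩
    have hR10 : ∀ y, y ∈ Set.Icc 1 44 ∪ {46} ∪ Set.Icc 50 55 ∪ {58} ∪ Set.Icc 65 68 ∪ ({82, 100} : Set ℕ) →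
        y ∈ picardNumbers 10 := fun y hy ↦ by rw [picardNumbers_ten]; exact hy
    have hR9 : ∀ y, y ∈ Set.Icc 1 33 ∪ {35} ∪ Set.Icc 37 42 ∪ {45} ∪ Set.Icc 50 53 ∪ ({65, 81} : Set ℕ) →
        y ∈ picardNumbers 9 := fun y hy ↦ by rw [picardNumbers_nine]; exact hy
    have hR8 : ∀ y, y ∈ Set.Icc 1 32 ∪ {34} ∪ Set.Icc 36 40 ∪ ({50, 64} : Set ℕ) → y ∈ picardNumbers 8 :=
      fun y hy ↦ by rw [picardNumbers_eight]; exact hy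
    have hR5 : ∀ y, y ∈ Set.Icc 1 13 ∪ ({15, 17, 25} : Set ℕ) → y ∈ picardNumbers 5 :=
      fun y hy ↦ by rw [picardNumbers_five]; exact hy
    have hR3 : ∀ y, y ∈ Set.Icc 1 6 ∪ ({9} : Set ℕ) → y ∈ picardNumbers 3 :=
      fun y hy ↦ by rw [picardNumbers_three]; exact hy
    have hR2 : ∀ y, y ∈ ({1, 2, 3, 4} : Set ℕ) → y ∈ picardNumbers 2 :=
      fun y hy ↦ by rw [picardNumbers_two]; exact hy
    have hsq : ∀ {m y : ℕ}, y ∈ picardNumbers m → ∀ t : ℕ, t + m = 11 → t ^ 2 + y ∈ picardNumbers 11 :=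
      fun hy t ht ↦ ht ▸ sq_add_mem_picardNumbers_of_mem hy t
    rintro (((((hx | hx) | hx) | hx) | hx) | hx)
    · rw [Set.mem_Icc] at hx
      rcases Nat.lt_or_ge x 23 with h22 | h23
      · exact Icc_one_two_mul_subset_picardNumbers (g := 11) (by norm_num) (Set.mem_Icc.2 ⟨hx.1, by omega⟩)
      · rcases Nat.lt_or_ge x 46 with h45 | h46
        · have h := hsucc (x - 1) (hR10 (x - 1) (by simp only [Set.mem_union, Set.mem_Icc]; omega))
          rwa [show x - 1 + 1 = x by omega] at h
        · rcases (show x = 46 ∨ x = 47 ∨ x = 48 ∨ x = 49 ∨ x = 50 ∨ (51 ≤ x ∧ x ≤ 56) ∨ x = 57 by omega) with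
            rfl | rfl | rfl | rfl | rfl | h51 | rfl
          · exact hsq (hR9 42 (by simp)) 2 rfl
          · exact hsucc 46 (hR10 46 (by simp))
          · exact hsq (hR8 39 (by simp)) 3 rfl
          · exact hsq (hR9 45 (by simp)) 2 rfl
          · simpa using sq_add_one_mem_picardNumbers_add (k := 4) (by norm_num) 7
          · have h := hsucc (x - 1) (hR10 (x - 1) (by simp only [Set.mem_union, Set.mem_Icc]; omega))
            rwa [show x - 1 + 1 = x by omega] at h
          · exact hsq (hR9 53 (by simp)) 2 rfl
    · rcases hx with rfl | hx
      · exact hsucc 58 (hR10 58 (by simp))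
      · rw [Set.mem_singleton_iff] at hx
        subst hx
        exact hsq (hR5 25 (by simp)) 6 rfl
    · rw [Set.mem_Icc] at hx
      rcases (show x = 65 ∨ (66 ≤ x ∧ x ≤ 69) ∨ x = 70 by omega) with rfl | h66 | rfl
      · simpa using sq_add_one_mem_picardNumbers_add (k := 3) (by norm_num) 8
      · have h := hsucc (x - 1) (hR10 (x - 1) (by simp only [Set.mem_union, Set.mem_Icc]; omega))
        rwa [show x - 1 + 1 = x by omega] at h
      · exact hsq (hR3 6 (by simp)) 8 rfl
    · rw [Set.mem_singleton_iff] at hx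
      subst hx
      exact hsq (hR3 9 (by simp)) 8 rfl
    · rw [Set.mem_Icc] at hx
      have h := hsq (hR2 (x - 81) (by
        simp only [Set.mem_insert_iff, Set.mem_singleton_iff]; omega)) 9 rfl
      rwa [show 9 ^ 2 + (x - 81) = x by omega] at h
    · rcases hx with rfl | hx
      · simpa using sq_add_one_mem_picardNumbers_add (k := 1) (by norm_num) 10
      · rw [Set.mem_singleton_iff] at hx
        subst hx
        simpa using choose_add_sum_sq_mem_picardNumbers (S := Unit) (fun _ ↦ 11) 0

end Eleven

/-! ## §3 Isotypic factors of dimension `12` and `R_12` -/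

section Twelve

variable {E : Type u} [NormedAddCommGroup E] [NormedSpace ℂ E]

/-- The covering space of a complex torus is finite-dimensional over `ℂ`. [folklore] -/
private theorem finiteDimensional_complex_of_period₁₂ {ι : Type*} [Fintype ι] (Φ : (ι → ℝ) ≃L[ℝ] E) :
    FiniteDimensional ℂ E := by
  haveI : FiniteDimensional ℝ E := LinearEquiv.finiteDimensional Φ.toLinearEquiv
  exact Module.Finite.of_restrictScalars_finite ℝ ℂ E

/-- **Isotypic factors of dimension `12`**: `X` simple abelian, `n · dim X = 12` ⇒
`ρ(Xⁿ) ≤ 48 ∨ ρ(Xⁿ) ∈ {72, 78, 144}` (`(dim X, n) = (12,1)`: `ρ ≤ 24`; `(6,2)`: `2ρ + e ≤ 36`; `(4,3)`: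
`3ρ + 3e ≤ 48` (`e ∣ 8`); `(3,4)`: `4ρ + 6e ∈ {10, 30, 16, 48}` by the threefold table; `(2,6)`:
`6ρ + 15e ∈ {21, 42, 78, 72}` by the Shimura-sharp surface list; `(1,12)`: `12 + 66e ∈ {78, 144}`).
[cite: HulekLaface2019PicardNumbersAV, §6.2 (algorithm (ii)) with §2.2 Prop. 2.4, Cor. 2.5 and §5.1 Prop. 5.1] -/
theorem IsSimple.finrank_neronSeveriGroup_pow_of_mul_finrank_eq_twelve {ι : Type} [Fintype ι] [DecidableEq ι]
    [Nonempty ι] {X : (ι → ℝ) ≃L[ℝ] E} (hX : IsSimple X) (hA : IsAbelianVariety X) {n : ℕ} (hn : 0 < n)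
    (hm : n * finrank ℂ E = 12) :
    finrank ℤ (neronSeveriGroup (powPeriod X n)) ≤ 48 ∨ finrank ℤ (neronSeveriGroup (powPeriod X n)) = 72 ∨
      finrank ℤ (neronSeveriGroup (powPeriod X n)) = 78 ∨ finrank ℤ (neronSeveriGroup (powPeriod X n)) = 144 := by
  haveI : FiniteDimensional ℂ E := finiteDimensional_complex_of_period₁₂ X
  have hρn : finrank ℤ (neronSeveriGroup (powPeriod X n)) =
      n * finrank ℤ (neronSeveriGroup X) + n.choose 2 * finrank ℚ (endAlgRat X) :=
    hA.finrank_neronSeveriGroup_pow n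
  have hpe : finrank ℤ (neronSeveriGroup X) ≤ finrank ℚ (endAlgRat X) :=
    hA.finrank_neronSeveriGroup_le_finrank_endAlgRat
  have hed : finrank ℚ (endAlgRat X) ∣ 2 * finrank ℂ E := hX.finrank_endAlgRat_dvd_two_mul_finrank
  have he1 : 1 ≤ finrank ℚ (endAlgRat X) := one_le_finrank_endAlgRat X
  have hp1 : finrank ℂ E = 1 → finrank ℤ (neronSeveriGroup X) = 1 := fun h ↦
    finrank_neronSeveriGroup_eq_one_of_finrank_eq_one X h
  have hp2 : finrank ℂ E = 2 →
      (finrank ℤ (neronSeveriGroup X) = 1 ∧ finrank ℚ (endAlgRat X) = 1) ∨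
        (finrank ℤ (neronSeveriGroup X) = 2 ∧ finrank ℚ (endAlgRat X) = 2) ∨
        (finrank ℤ (neronSeveriGroup X) = 3 ∧ finrank ℚ (endAlgRat X) = 4) ∨
        (finrank ℤ (neronSeveriGroup X) = 2 ∧ finrank ℚ (endAlgRat X) = 4) := fun h ↦ by
    obtain ⟨η, hη⟩ := hA
    exact hX.finrank_neronSeveriGroup_and_finrank_endAlgRat_of_finrank_eq_two hη h
  have hp3 : finrank ℂ E = 3 →
      (finrank ℤ (neronSeveriGroup X) = 1 ∧ finrank ℚ (endAlgRat X) = 1) ∨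
        (finrank ℤ (neronSeveriGroup X) = 3 ∧ finrank ℚ (endAlgRat X) = 3) ∨
        (finrank ℤ (neronSeveriGroup X) = 1 ∧ finrank ℚ (endAlgRat X) = 2) ∨
        (finrank ℤ (neronSeveriGroup X) = 3 ∧ finrank ℚ (endAlgRat X) = 6) := fun h ↦ by
    obtain ⟨η, hη⟩ := hA
    exact hX.finrank_neronSeveriGroup_of_finrank_eq_three hη h
  have hdpos : 0 < finrank ℂ E := finrank_pos_of_nonempty X
  set p := finrank ℤ (neronSeveriGroup X) with hp
  set e := finrank ℚ (endAlgRat X) with he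
  set d := finrank ℂ E with hd
  rw [hρn]
  have hn12 : n ≤ 12 := by nlinarith
  interval_cases n
  · have hd12 : d = 12 := by omega
    rw [hd12] at hed
    have := Nat.le_of_dvd (by norm_num) hed
    simp only [one_mul, show Nat.choose 1 2 = 0 by decide, zero_mul, add_zero]
    omega
  · have hd6 : d = 6 := by omega
    rw [hd6] at hed
    have := Nat.le_of_dvd (by norm_num) hed
    simp only [show Nat.choose 2 2 = 1 by decide, one_mul]
    omega
  · have hd4 : d = 4 := by omega
    rw [hd4] at hed
    have := Nat.le_of_dvd (by norm_num) hed
    simp only [show Nat.choose 3 2 = 3 by decide]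
    omega
  · have hd3 : d = 3 := by omega
    simp only [show Nat.choose 4 2 = 6 by decide]
    rcases hp3 hd3 with ⟨h1, h2⟩ | ⟨h1, h2⟩ | ⟨h1, h2⟩ | ⟨h1, h2⟩ <;> omega
  · omega
  · have hd2 : d = 2 := by omega
    simp only [show Nat.choose 6 2 = 15 by decide]
    rcases hp2 hd2 with ⟨h1, h2⟩ | ⟨h1, h2⟩ | ⟨h1, h2⟩ | ⟨h1, h2⟩ <;> omega
  · omega
  · omega
  · omega
  · omega
  · omega
  · have hd1 : d = 1 := by omega
    rw [hd1] at hed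
    have h2 := Nat.le_of_dvd (by norm_num) hed
    have h1 := hp1 hd1
    simp only [show Nat.choose 12 2 = 66 by decide]
    interval_cases e <;> omega

/-- **`R_12 = {1, …, 62} ∪ {64, …, 72} ∪ {74} ∪ {78, 80} ∪ {82, …, 87} ∪ {90} ∪ {101, …, 104} ∪ {122, 144}`** —
the algorithm of §6.2 at `g = 12` (step (iv) with `R_1, …, R_11` and the isotypic factors of dimension `12`;
witnesses: `{1, …, 24}` (Prop. 6.4), `R_11 + 1`, `59 = 2² + 55`, `61 = 3² + 52`, `64 = 7² + 15`, `65 = 8² + 1`,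
`72 = 6² + 36`, `78 = C(13, 2)`, `80 = 8² + 16`, `82 = 9² + 1`, `87 = 9² + 6`, `90 = 9² + 9`,
`101, 103, 104 = 10² + {1, 3, 4}`, `122 = 11² + 1`, `144 = 12²`).  In particular `63, 73, 75, 76, 77, 79, 81,
88, 89, 91, …, 100 ∉ R_12`.  The value is the algorithm's output (not printed in the held text).
[cite: HulekLaface2019PicardNumbersAV, §6.2 (algorithm (i)–(iv)) with Prop. 6.4, Remark 6.5] -/
theorem picardNumbers_twelve :
    picardNumbers 12 = Set.Icc 1 62 ∪ Set.Icc 64 72 ∪ {74, 78, 80} ∪ Set.Icc 82 87 ∪ {90} ∪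
      Set.Icc 101 104 ∪ {122, 144} := by
  ext x
  constructor
  · intro hx
    have hx144 := picardNumbers_subset_Icc (by norm_num : 1 ≤ 12) hx
    rw [Set.mem_Icc] at hx144
    obtain ⟨A, hA, rfl⟩ := hx
    have hS := hA.finrank_neronSeveriGroup_mem_of_pow_of_add (by rw [Module.finrank_fin_fun]; norm_num)
      {y | y ≤ 62 ∨ (64 ≤ y ∧ y ≤ 72) ∨ y = 74 ∨ y = 78 ∨ y = 80 ∨ (82 ≤ y ∧ y ≤ 87) ∨ y = 90 ∨
        (101 ≤ y ∧ y ≤ 104) ∨ y = 122 ∨ y = 144}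
      (fun κ _ _ _ F _ _ X hX hXab n hn hm ↦ by
        rw [Module.finrank_fin_fun] at hm
        rcases hX.finrank_neronSeveriGroup_pow_of_mul_finrank_eq_twelve hXab hn hm with h | h | h | h <;>
          simp only [Set.mem_setOf_eq] <;> omega)
      (fun m hm0 hm12 a ha b hb ↦ by
        rw [Module.finrank_fin_fun] at hm12 hb
        simp only [Set.mem_setOf_eq]
        interval_cases m
        · rw [picardNumbers_one] at ha; rw [picardNumbers_eleven] at hb
          simp only [Set.mem_singleton_iff, Set.mem_union, Set.mem_Icc, Set.mem_insert_iff] at ha hb; omega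
        · rw [picardNumbers_two] at ha; rw [picardNumbers_ten] at hb
          simp only [Set.mem_singleton_iff, Set.mem_union, Set.mem_Icc, Set.mem_insert_iff] at ha hb; omega
        · rw [picardNumbers_three] at ha; rw [picardNumbers_nine] at hb
          simp only [Set.mem_singleton_iff, Set.mem_union, Set.mem_Icc, Set.mem_insert_iff] at ha hb; omega
        · rw [picardNumbers_four] at ha; rw [picardNumbers_eight] at hb
          simp only [Set.mem_singleton_iff, Set.mem_union, Set.mem_Icc, Set.mem_insert_iff] at ha hb; omega
        · rw [picardNumbers_five] at ha; rw [picardNumbers_seven] at hb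
          simp only [Set.mem_singleton_iff, Set.mem_union, Set.mem_Icc, Set.mem_insert_iff] at ha hb; omega
        · rw [picardNumbers_six] at ha; rw [picardNumbers_six] at hb
          simp only [Set.mem_singleton_iff, Set.mem_union, Set.mem_Icc, Set.mem_insert_iff] at ha hb; omega
        · rw [picardNumbers_seven] at ha; rw [picardNumbers_five] at hb
          simp only [Set.mem_singleton_iff, Set.mem_union, Set.mem_Icc, Set.mem_insert_iff] at ha hb; omega
        · rw [picardNumbers_eight] at ha; rw [picardNumbers_four] at hb
          simp only [Set.mem_singleton_iff, Set.mem_union, Set.mem_Icc, Set.mem_insert_iff] at ha hb; omega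
        · rw [picardNumbers_nine] at ha; rw [picardNumbers_three] at hb
          simp only [Set.mem_singleton_iff, Set.mem_union, Set.mem_Icc, Set.mem_insert_iff] at ha hb; omega
        · rw [picardNumbers_ten] at ha; rw [picardNumbers_two] at hb
          simp only [Set.mem_singleton_iff, Set.mem_union, Set.mem_Icc, Set.mem_insert_iff] at ha hb; omega
        · rw [picardNumbers_eleven] at ha; rw [picardNumbers_one] at hb
          simp only [Set.mem_singleton_iff, Set.mem_union, Set.mem_Icc, Set.mem_insert_iff] at ha hb; omega)
    simp only [Set.mem_setOf_eq] at hS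
    simp only [Set.mem_union, Set.mem_Icc, Set.mem_insert_iff, Set.mem_singleton_iff]
    omega
  · have hsucc : ∀ y ∈ picardNumbers 11, y + 1 ∈ picardNumbers 12 := fun y hy ↦
      image_succ_picardNumbers_subset 11 ⟨y, hy, rfl⟩
    have hR11 : ∀ y, y ∈ Set.Icc 1 57 ∪ {59, 61} ∪ Set.Icc 65 70 ∪ {73} ∪ Set.Icc 82 85 ∪ ({101, 121} : Set ℕ) →
        y ∈ picardNumbers 11 := fun y hy ↦ by rw [picardNumbers_eleven]; exact hy
    have hR10 : ∀ y, y ∈ Set.Icc 1 44 ∪ {46} ∪ Set.Icc 50 55 ∪ {58} ∪ Set.Icc 65 68 ∪ ({82, 100} : Set ℕ) →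
        y ∈ picardNumbers 10 := fun y hy ↦ by rw [picardNumbers_ten]; exact hy
    have hR9 : ∀ y, y ∈ Set.Icc 1 33 ∪ {35} ∪ Set.Icc 37 42 ∪ {45} ∪ Set.Icc 50 53 ∪ ({65, 81} : Set ℕ) →
        y ∈ picardNumbers 9 := fun y hy ↦ by rw [picardNumbers_nine]; exact hy
    have hR6 : ∀ y, y ∈ Set.Icc 1 21 ∪ ({26, 36} : Set ℕ) → y ∈ picardNumbers 6 :=
      fun y hy ↦ by rw [picardNumbers_six]; exact hy
    have hR5 : ∀ y, y ∈ Set.Icc 1 13 ∪ ({15, 17, 25} : Set ℕ) → y ∈ picardNumbers 5 :=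
      fun y hy ↦ by rw [picardNumbers_five]; exact hy
    have hR4 : ∀ y, y ∈ Set.Icc 1 8 ∪ ({10, 16} : Set ℕ) → y ∈ picardNumbers 4 :=
      fun y hy ↦ by rw [picardNumbers_four]; exact hy
    have hR3 : ∀ y, y ∈ Set.Icc 1 6 ∪ ({9} : Set ℕ) → y ∈ picardNumbers 3 :=
      fun y hy ↦ by rw [picardNumbers_three]; exact hy
    have hR2 : ∀ y, y ∈ ({1, 2, 3, 4} : Set ℕ) → y ∈ picardNumbers 2 :=
      fun y hy ↦ by rw [picardNumbers_two]; exact hy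
    have hsq : ∀ {m y : ℕ}, y ∈ picardNumbers m → ∀ t : ℕ, t + m = 12 → t ^ 2 + y ∈ picardNumbers 12 :=
      fun hy t ht ↦ ht ▸ sq_add_mem_picardNumbers_of_mem hy t
    rintro ((((((hx | hx) | hx) | hx) | hx) | hx) | hx)
    · rw [Set.mem_Icc] at hx
      rcases Nat.lt_or_ge x 25 with h24 | h25
      · exact Icc_one_two_mul_subset_picardNumbers (g := 12) (by norm_num) (Set.mem_Icc.2 ⟨hx.1, by omega⟩)
      · rcases Nat.lt_or_ge x 59 with h58 | h59
        · have h := hsucc (x - 1) (hR11 (x - 1) (by simp only [Set.mem_union, Set.mem_Icc]; omega))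
          rwa [show x - 1 + 1 = x by omega] at h
        · rcases (show x = 59 ∨ x = 60 ∨ x = 61 ∨ x = 62 by omega) with rfl | rfl | rfl | rfl
          · exact hsq (hR10 55 (by simp)) 2 rfl
          · exact hsucc 59 (hR11 59 (by simp))
          · exact hsq (hR9 52 (by simp)) 3 rfl
          · exact hsucc 61 (hR11 61 (by simp))
    · rw [Set.mem_Icc] at hx
      rcases (show x = 64 ∨ x = 65 ∨ (66 ≤ x ∧ x ≤ 71) ∨ x = 72 by omega) with rfl | rfl | h66 | rfl
      · exact hsq (hR5 15 (by simp)) 7 rfl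
      · simpa using sq_add_one_mem_picardNumbers_add (k := 4) (by norm_num) 8
      · have h := hsucc (x - 1) (hR11 (x - 1) (by simp only [Set.mem_union, Set.mem_Icc]; omega))
        rwa [show x - 1 + 1 = x by omega] at h
      · exact hsq (hR6 36 (by simp)) 6 rfl
    · rcases hx with rfl | rfl | hx
      · exact hsucc 73 (hR11 73 (by simp))
      · simpa [show Nat.choose 13 2 = 78 by decide] using
          choose_add_sum_sq_mem_picardNumbers (S := Fin 0) (fun _ ↦ 0) 12
      · rw [Set.mem_singleton_iff] at hx
        subst hx
        exact hsq (hR4 16 (by simp)) 8 rfl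
    · rw [Set.mem_Icc] at hx
      rcases (show x = 82 ∨ (83 ≤ x ∧ x ≤ 86) ∨ x = 87 by omega) with rfl | h83 | rfl
      · simpa using sq_add_one_mem_picardNumbers_add (k := 3) (by norm_num) 9
      · have h := hsucc (x - 1) (hR11 (x - 1) (by simp only [Set.mem_union, Set.mem_Icc]; omega))
        rwa [show x - 1 + 1 = x by omega] at h
      · exact hsq (hR3 6 (by simp)) 9 rfl
    · rw [Set.mem_singleton_iff] at hx
      subst hx
      exact hsq (hR3 9 (by simp)) 9 rfl
    · rw [Set.mem_Icc] at hx
      rcases (show x = 101 ∨ x = 102 ∨ x = 103 ∨ x = 104 by omega) with rfl | rfl | rfl | rfl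
      · simpa using sq_add_one_mem_picardNumbers_add (k := 2) (by norm_num) 10
      · exact hsucc 101 (hR11 101 (by simp))
      · exact hsq (hR2 3 (by simp)) 10 rfl
      · exact hsq (hR2 4 (by simp)) 10 rfl
    · rcases hx with rfl | hx
      · simpa using sq_add_one_mem_picardNumbers_add (k := 1) (by norm_num) 11
      · rw [Set.mem_singleton_iff] at hx
        subst hx
        simpa using choose_add_sum_sq_mem_picardNumbers (S := Unit) (fun _ ↦ 12) 0

end Twelve

end ComplexTorus

end Literature.Geometry.Kaehler

end
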